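import Summits.BirchSwinnertonDyer.BirchSwinnertonDyer.Theorems.KimAtThreeD7uTamagawaKuriharaEnd
import Summits.BirchSwinnertonDyer.Rank1Residual.GaloisImage.PrimeChoiceSakamotoDual
import Summits.BirchSwinnertonDyer.Rank1Residual.GaloisImage.PrimeChoiceSakamotoDeep
import Summits.BirchSwinnertonDyer.Rank1Residual.GaloisImage.KolyvaginDeepFamily
import Summits.BirchSwinnertonDyer.Rank1Residual.GaloisImage.CanonicalKolyvaginDatumAdmissibleDeep
import Summits.BirchSwinnertonDyer.Rank1Residual.GaloisImage.KuriharaTowerPackaging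
import Summits.BirchSwinnertonDyer.Rank1Residual.GaloisImage.KolyvaginScalarTransportLocal
import Summits.BirchSwinnertonDyer.Rank1Residual.GaloisImage.InflationRestrictionSakamotoH3
import Summits.BirchSwinnertonDyer.Rank1Residual.Additive.GordCycLowerBoundOfControlTamagawaSharp
import HarnessLib

/-!
# The TAMAGAWA-DIVISIBLE bad places, XXVI: the tower DISCHARGE — every binder of part XV-le that is
# data of the Kolyvagin-system machinery (one `τ`, the pinned canonical admissible data `D j`, `j ≤ m`,
# the level-one prime choice with a dual class, `E[3^j·3]^{Γ_ℚ} = 0`, the admissible set `T`, the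
# Poitou–Tate family) is a THEOREM under the `3`-adic tower and the named fact
# `poitouTate_selmerStructure_duality ℚ`; hence the END of part XXV with ONLY print-shaped inputs left
# (cell `bsd-addord`, seat w2-tamdiv gen 7; route W2 `KimAtThreeKolyvagin`, items 19679 / 19562 / 19599 (TD),
# 19560)

HONEST FRAMING: TOOL / END theorems (no definition, no named fact, no `sorry`); closes nothing by itself;
nothing is booked; BSD is not proved by any of this.  This file is also the CERTIFICATE OF NON-VACUITY of the
bounded («-le») binder families of `…DefectExponentLe` / `…KuriharaDeepLe` / `…KuriharaEnd`: it CONSTRUCTS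
them for every tower row (the unbounded `∀ j` families of parts XIII/XV/XVII–XXI/XXIII admit no construction).

## What

* §1 `infinite_setOf_mem_frobeniusClassPrimes_localization_ne_zero_torsion_dual_deep` — [MR04]
  Prop. 3.6.1 with Sakamoto's proof ON THE DEEP CLASS: under the tower, for non-zero `c ∈ H¹(ℚ, E[3])`,
  `c* ∈ H¹(ℚ, E[3]^D)`, infinitely many `𝔮` in the class of `τ` through `E[3^m·3]` with
  `loc_𝔮 c ≠ 0 ∧ loc_𝔮 c* ≠ 0` (n1011-p15's `…_torsion_dual`, with the one-module deep theorem
  `PrimeChoice.infinite_setOf_mem_frobeniusClassPrimes_forall_localization_ne_zero_deep` and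
  `hH3_three_of_towerSurj` in place of the level-`3` ones; the dual class transported by the inverse Weil
  transport `X11b.LocBridge.weilDualInv`).  This is the binder `hprime` of parts IX–XXV on PINNED data.
* §2 `exists_pinnedData_of_towerSurj` — under the tower, for every `m` and every family of primitive
  roots `η`: a finite `T = {v ∣ 3} ∪ {bad v}` (`TowerPackage.towerAdmissible`), ONE `τ` with
  (H.2)-cokernels at every level and fixing every `μ_{3^n}` (`S24Deep.exists_tau_forall_levels_of_towerSurj`),
  and data `D j` (ALL `j`) on the class of `τ` through `E[3^m·3]` off `T` with cyclotomic transverse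
  conditions, THE canonical comparison maps and admissibility FOR `j ≤ m`
  (`S24Deep.exists_kolyvaginDatum_hasCanonicalComparison_frobeniusClassPrimes_deep`,
  `isAdmissible_of_hasCanonicalComparison_torsion_deep`; for `j > m` the datum with `fs = 0`), and the
  prime choice of §1 on `(D 0).primes`.
* §3 **`natCast_le_kuriharaPartialDeepInfty_of_zetaBody_of_towerSurj`** (+ `v₃` form) — THE END with
  every Kolyvagin-datum binder DISCHARGED: tower + `3^{m+1} ∣ c_ℓ` at one finite `ℓ ∤ 3` + the named facts
  `poitouTate_selmerStructure_duality ℚ` / Tate's `hEP` + primitive roots `η` + ★ PK-6₂'s displayed inputs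
  (`ZetaBody` for `P₀.f`, riders, `hcdA`, `ht0`, value rows) ⇒ **`(m + 1 : ℕ∞) ≤ kuriharaPartialDeepInfty W 3 P₀.f`**.

References: [MazurRubin2004] Prop. 3.6.1, Lemma 1.2.3, §3.5, App. A; [Sakamoto2024] §2, Lemma 5.2, Cor. 5.5;
[Rubin2011] Def. 1.9.6; [MilneADT2006] I 4.10; [Buyukboduk2009TamagawaDefect] Thm. 3.1; [Kim2022StructureSelmer] 3.13.
-/

noncomputable section

-- the cell's Theorems namespace `Summit.BirchSwinnertonDyer.BirchSwinnertonDyer.…` repeats the summit name by design (D-0017)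
set_option linter.dupNamespace false

open scoped NumberField TensorProduct ContRepresentation Classical
open CategoryTheory Field Function Finset IsDedekindDomain NumberField WeierstrassCurve
open Rat.HeightOneSpectrum
open Literature.NumberTheory.GaloisRepresentations Literature.NumberTheory.GaloisCohomology
open Literature.NumberTheory.GaloisRepresentations.DiscreteGaloisModule
open Literature.NumberTheory.EllipticCurves Literature.NumberTheory.EllipticCurves.ModularForms
open Literature.NumberTheory.EllipticCurves.Kato2004
open Literature.NumberTheory.EllipticCurves.Kato2004.EulerSystemValues
open Summit.BirchSwinnertonDyer.Rank1Residual.GaloisImage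
open Summit.BirchSwinnertonDyer.Rank1Residual.X11b.LocBridge
open Summit.BirchSwinnertonDyer.BirchSwinnertonDyer.Theorems.KimAtThreeD7uTamagawaKuriharaEnd

namespace Summit.BirchSwinnertonDyer.BirchSwinnertonDyer.Theorems.KimAtThreeD7uTamagawaKuriharaTower

/-! ### §1 The level-one prime choice with a dual class ON THE DEEP CLASS -/

section PrimeChoice

variable (W : WeierstrassCurve ℚ) [W.IsElliptic]

/-- **[MR04] Prop. 3.6.1 for `E[3]` on the DEEP class under the `3`-adic tower**: for non-zero
`c ∈ H¹(ℚ, E[3])` and `c* ∈ H¹(ℚ, E[3]^D)`, any finite `S`, and `τ` with `E[3]/(τ − 1) ≃ ℤ/3`: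
infinitely many `𝔮 ∈ frobeniusClassPrimes (E[3^m·3]) S τ 3^{m+1}` have `loc_𝔮 c ≠ 0 ∧ loc_𝔮 c* ≠ 0`
(the dual class transported to `H¹(ℚ, E[3])` by `weilDualInv`, injective on `H¹`; Sakamoto's Cor. 5.5
for two classes on the deep class, (H.1) from surj(3), (H.3) in the deep form `hH3_three_of_towerSurj`).
[cite: MazurRubin2004, Prop. 3.6.1 (pp. 30–31)] [cite: Sakamoto2024, Lemma 5.2 and Cor. 5.5 (pp. 928–930)]
[cite: MilneADT2006, Ch. I §6, proof of Prop. 6.9] -/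
theorem infinite_setOf_mem_frobeniusClassPrimes_localization_ne_zero_torsion_dual_deep
    [Finite (geomTorsion W ((3 : ℕ) : ℤ))]
    (htower : ∀ n : ℕ, W.HasSurjectiveModNGaloisRep (3 ^ n : ℕ)) (m : ℕ)
    (S : Set (HeightOneSpectrum (𝓞 ℚ))) (hS : S.Finite) {τ : absoluteGaloisGroup ℚ}
    (hτ : Nonempty (cokerSubOne (W.torsionGaloisModule ((3 : ℕ) : ℤ)) τ ≃+ ZMod 3))
    (c : galoisCohomology (W.torsionGaloisModule ((3 : ℕ) : ℤ)) 1) (hc : c ≠ 0)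
    (c' : galoisCohomology ((W.torsionGaloisModule ((3 : ℕ) : ℤ)).tateDual 3) 1) (hc' : c' ≠ 0) :
    {q | q ∈ frobeniusClassPrimes (W.torsionGaloisModule (((3 : ℕ) : ℤ) ^ m * ((3 : ℕ) : ℤ))) S τ
        (3 ^ (m + 1)) ∧
      galoisCohomology.localization (W.torsionGaloisModule ((3 : ℕ) : ℤ)) (Sum.inr q) 1 c ≠ 0 ∧
      galoisCohomology.localization ((W.torsionGaloisModule ((3 : ℕ) : ℤ)).tateDual 3) (Sum.inr q) 1 c'
        ≠ 0}.Infinite := by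
  haveI : Fact (Nat.Prime 3) := ⟨Nat.prime_three⟩
  haveI : NeZero (3 : ℕ) := ⟨by norm_num⟩
  haveI : NeZero ((3 : ℕ) : ℚ) := ⟨by norm_num⟩
  have hsurj : W.HasSurjectiveModNGaloisRep ((3 : ℕ) : ℤ) := by simpa using htower 1
  obtain ⟨e, hμ, hadd₁, hadd₂, -, hnondeg, hgal⟩ :=
    exists_weilPairing_holds W 3 (by norm_num) (by norm_num)
  have hirr := hasIrreducibleModPGaloisRep_of_hasSurjectiveModNGaloisRep W 3 hsurj
  haveI : Finite (geomTorsion W (((3 : ℕ) : ℤ) ^ m * ((3 : ℕ) : ℤ))) := finite_geomTorsion_pow_mul W 3 m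
  have hker : ∀ u : absoluteGaloisGroup ℚ,
      W.torsionGaloisModule (((3 : ℕ) : ℤ) ^ m * ((3 : ℕ) : ℤ)) u = 1 →
        W.torsionGaloisModule ((3 : ℕ) : ℤ) u = 1 := fun u hu =>
    S24Deep.torsionGaloisModule_eq_one_of_dvd W (Dvd.intro_left _ rfl) u hu
  set θ' := weilDualInv W 3 e hμ hadd₁ hadd₂ hgal hnondeg with hθ'def
  have hθ' : Injective (galoisCohomology.map θ' 1) := by
    intro y y' h
    have h' := congrArg (galoisCohomology.map (weilDualIntertwining W 3 e hμ hadd₁ hadd₂ hgal) 1) h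
    rwa [map_weilDual_map_weilDualInv, map_weilDual_map_weilDualInv] at h'
  -- the two classes of `H¹(ℚ, E[3])`: `c` and the transported `H¹(w⁻¹) c*`
  let d : Fin 2 → galoisCohomology (W.torsionGaloisModule ((3 : ℕ) : ℤ)) 1 :=
    ![c, galoisCohomology.map θ' 1 c']
  have hd : ∀ i, d i ≠ 0 := by
    intro i
    fin_cases i
    · exact hc
    · exact fun h => hc' (hθ' (by rw [map_zero]; exact h))
  have hInf := PrimeChoice.infinite_setOf_mem_frobeniusClassPrimes_forall_localization_ne_zero_deep
    (W.torsionGaloisModule ((3 : ℕ) : ℤ)) (W.torsionGaloisModule (((3 : ℕ) : ℤ) ^ m * ((3 : ℕ) : ℤ)))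
    hker (p := 3) (N' := 3 ^ (m + 1)) (pow_ne_zero _ (by norm_num)) S hS hτ
    (fun A hA => hirr A fun σ P hP => hA σ P hP) (hH3_three_of_towerSurj W m htower) (n := 2)
    (by norm_num) d hd
  refine hInf.mono ?_
  rintro q ⟨hq, hloc⟩
  refine ⟨hq, hloc 0, fun h0 => hloc 1 ?_⟩
  show galoisCohomology.localization _ (Sum.inr q) 1 (galoisCohomology.map θ' 1 c') = 0
  rw [CoreRankZero.localization_map_one_eq θ' (Sum.inr q) c', h0]
  exact map_zero _

end PrimeChoice

/-! ### §2 The pinned data under the tower -/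

section Data

variable (W : WeierstrassCurve ℚ) [W.IsElliptic]

/-- **`E[3^j·3]^{Γ_ℚ} = 0` at every level under surj(3)** (n1011-p11 T-R18c, in the `torsionGaloisModule`
spelling of part XV's binder `h0`). [cite: Serre1972, §5.2 (iv) and §5.4] -/
theorem torsion_fixed_eq_zero_of_towerSurj (htower : ∀ n : ℕ, W.HasSurjectiveModNGaloisRep (3 ^ n : ℕ))
    (j : ℕ) (Q : geomTorsion W (((3 : ℕ) : ℤ) ^ j * ((3 : ℕ) : ℤ)))
    (hQ : ∀ σ : absoluteGaloisGroup ℚ, W.torsionGaloisModule (((3 : ℕ) : ℤ) ^ j * ((3 : ℕ) : ℤ)) σ Q = Q) :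
    Q = 0 :=
  Transport.geomTorsion_eq_zero_of_fixed_of_surj W (by simpa using htower 1) j Q fun σ => by
    rw [← torsionGaloisModule_apply_apply]; exact hQ σ

/-- **The pinned data under the tower** (module docstring §2): `T`, `τ`, and `D j` for all `j` on the
class of `τ` through `E[3^m·3]` off `T`, canonical and admissible for `j ≤ m`, with the level-one prime
choice of §1 on `(D 0).primes`. [cite: Sakamoto2024, §2 (pp. 920–921) and §4 (p. 925)]
[cite: MazurRubin2004, Lemma 1.2.3, Prop. 3.6.1 and §3.5 (H.5)] [cite: Rubin2011, Def. 1.9.6 and Exercise 1.9.7] -/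
theorem exists_pinnedData_of_towerSurj [Finite (geomTorsion W ((3 : ℕ) : ℤ))]
    [Finite (geomTorsion W (((3 : ℕ) : ℤ) ^ 0 * ((3 : ℕ) : ℤ)))]
    (htower : ∀ n : ℕ, W.HasSurjectiveModNGaloisRep (3 ^ n : ℕ)) (m : ℕ)
    (η : (q : HeightOneSpectrum (𝓞 ℚ)) → (ZMod (Ideal.absNorm q.asIdeal))ˣ)
    (hη : ∀ q, Subgroup.zpowers (η q) = ⊤) :
    ∃ (T : Finset (HeightOneSpectrum (𝓞 ℚ))) (τ : absoluteGaloisGroup ℚ)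
      (D : (j : ℕ) → KolyvaginDatum (W.torsionGaloisModule (((3 : ℕ) : ℤ) ^ j * ((3 : ℕ) : ℤ)))),
      (∀ v : HeightOneSpectrum (𝓞 ℚ), ((3 : ℕ) : 𝓞 ℚ) ∈ v.asIdeal → v ∈ T) ∧
      (∀ v : HeightOneSpectrum (𝓞 ℚ), ¬ W.HasGoodReductionAt v → v ∈ T) ∧
      (∀ v, v ∈ (↑T : Set (HeightOneSpectrum (𝓞 ℚ))) ↔
        (¬ W.HasGoodReductionAt v ∨ ((3 : ℕ) : 𝓞 ℚ) ∈ v.asIdeal)) ∧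
      (∀ j : ℕ, Nonempty (cokerSubOne (W.torsionGaloisModule (((3 : ℕ) : ℤ) ^ j * ((3 : ℕ) : ℤ))) τ ≃+
        ZMod (3 ^ (j + 1)))) ∧
      Nonempty (cokerSubOne (W.torsionGaloisModule ((3 : ℕ) : ℤ)) τ ≃+ ZMod 3) ∧
      (∀ n : ℕ, τ ∈ rootsOfUnityFixer ℚ (3 ^ n)) ∧
      (∀ j, (D j).primes = frobeniusClassPrimes
        (W.torsionGaloisModule (((3 : ℕ) : ℤ) ^ m * ((3 : ℕ) : ℤ))) ↑T τ (3 ^ (m + 1))) ∧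
      (∀ q ∈ frobeniusClassPrimes
        (W.torsionGaloisModule (((3 : ℕ) : ℤ) ^ m * ((3 : ℕ) : ℤ))) ↑T τ (3 ^ (m + 1)), q ∉ T) ∧
      (∀ j, (D j).transverse = cyclotomicTransverse _) ∧
      (∀ j, j ≤ m → (D j).HasCanonicalComparison (3 ^ (j + 1)) η) ∧
      (∀ j, j ≤ m → (D j).IsAdmissible) ∧
      (∀ c : galoisCohomology (W.torsionGaloisModule (((3 : ℕ) : ℤ) ^ 0 * ((3 : ℕ) : ℤ))) 1, c ≠ 0 →
        ∀ c' : galoisCohomology (DiscreteGaloisModule.tateDual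
          (W.torsionGaloisModule (((3 : ℕ) : ℤ) ^ 0 * ((3 : ℕ) : ℤ))) 3) 1, c' ≠ 0 →
        {q ∈ (D 0).primes |
          galoisCohomology.localization (W.torsionGaloisModule (((3 : ℕ) : ℤ) ^ 0 * ((3 : ℕ) : ℤ)))
            (Sum.inr q) 1 c ≠ 0 ∧
          galoisCohomology.localization (DiscreteGaloisModule.tateDual
            (W.torsionGaloisModule (((3 : ℕ) : ℤ) ^ 0 * ((3 : ℕ) : ℤ))) 3) (Sum.inr q) 1 c' ≠ 0}.Infinite) := by
  haveI : Fact (Nat.Prime 3) := ⟨Nat.prime_three⟩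
  -- `T = {v ∣ 3} ∪ {bad v}`
  obtain ⟨T, h3T, hbadT, hTmem, -, -, -, -, -⟩ := TowerPackage.towerAdmissible W
  have hTiff : ∀ v, v ∈ (↑T : Set (HeightOneSpectrum (𝓞 ℚ))) ↔
      (¬ W.HasGoodReductionAt v ∨ ((3 : ℕ) : 𝓞 ℚ) ∈ v.asIdeal) := fun v =>
    ⟨fun hv => hTmem v (Finset.mem_coe.mp hv), fun h => Finset.mem_coe.mpr (h.elim (hbadT v) (h3T v))⟩
  -- ONE `τ` for all levels
  obtain ⟨τ, hτμ, hτq⟩ := S24Deep.exists_tau_forall_levels_of_towerSurj W htower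
  have hτ0 : Nonempty (cokerSubOne (W.torsionGaloisModule ((3 : ℕ) : ℤ)) τ ≃+ ZMod 3) := by
    have h := hτq 0
    rwa [pow_zero, one_mul, zero_add, pow_one] at h
  -- the pinned class and the data
  set P := frobeniusClassPrimes (W.torsionGaloisModule (((3 : ℕ) : ℤ) ^ m * ((3 : ℕ) : ℤ))) ↑T τ
    (3 ^ (m + 1)) with hPdef
  have hdat : ∀ j : ℕ, ∃ Dj : KolyvaginDatum (W.torsionGaloisModule (((3 : ℕ) : ℤ) ^ j * ((3 : ℕ) : ℤ))),
      Dj.primes = P ∧ Dj.transverse = cyclotomicTransverse _ ∧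
        (j ≤ m → Dj.HasCanonicalComparison (3 ^ (j + 1)) η) := by
    intro j
    by_cases hj : j ≤ m
    · haveI : NeZero (3 ^ (j + 1)) := ⟨pow_ne_zero _ three_ne_zero⟩
      obtain ⟨Dj, hP', hT', hD'⟩ :=
        S24Deep.exists_kolyvaginDatum_hasCanonicalComparison_frobeniusClassPrimes_deep
          (W.torsionGaloisModule (((3 : ℕ) : ℤ) ^ j * ((3 : ℕ) : ℤ)))
          (W.torsionGaloisModule (((3 : ℕ) : ℤ) ^ m * ((3 : ℕ) : ℤ))) (3 ^ (j + 1)) (3 ^ (m + 1))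
          (fun u hu => S24Deep.torsionGaloisModule_pow_mul_eq_one_of_le W ((3 : ℕ) : ℤ) hj u hu)
          (pow_dvd_pow 3 (Nat.succ_le_succ hj)) ↑T (hτμ (m + 1)) (hτq j) (cyclotomicTransverse _) η
          (fun q _ => hη q)
      exact ⟨Dj, hP', hT', fun _ => hD'⟩
    · exact ⟨⟨P, cyclotomicTransverse _, fun _ => 0⟩, rfl, rfl, fun h => absurd h hj⟩
  choose D hDP hDT hDcan using hdat
  have hadm : ∀ j, j ≤ m → (D j).IsAdmissible := fun j hj =>
    isAdmissible_of_hasCanonicalComparison_torsion_deep W j m hj ↑T (hτμ (m + 1)) (hτq j) (hDP j)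
      (hDcan j hj)
  refine ⟨T, τ, D, h3T, hbadT, hTiff, hτq, hτ0, hτμ, hDP, fun q hq hqT => hq.1 (Finset.mem_coe.mpr hqT),
    hDT, hDcan, hadm, fun c hc c' hc' => ?_⟩
  -- the level-one prime choice on `(D 0).primes = P` (§1, read on `E[3] = E[3^0·3]`)
  rw [hDP 0]
  exact infinite_setOf_mem_frobeniusClassPrimes_localization_ne_zero_torsion_dual_deep W htower m ↑T
    T.finite_toSet hτ0 c hc c' hc'

end Data

/-! ### §3 THE END with every Kolyvagin-datum binder discharged -/

section End

variable (W : WeierstrassCurve ℚ) [W.IsElliptic] [W.IsGloballyMinimal]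
  [ContinuousSMul ℤ_[3] (W.tateModule 3)] [Module.Free ℤ_[3] (W.tateModule 3)]
  [Module.Finite ℤ_[3] (W.tateModule 3)]

/-- Local notation: `𝐃F⟦r, τ⟧ ℓ = Σ_{j<ℓ−1} j·σ_{χ_{m(0,r)}(τ_ℓ)}^j` (n1011 PK-1 ★2's spelling, `p = 3`). -/
local notation3 (prettyPrint := false) "𝐃F⟦" r ", " τ "⟧" =>
  fun ℓ : HeightOneSpectrum (𝓞 ℚ) =>
  ∑ j ∈ Finset.range (((primesEquiv ℓ : Nat.Primes) : ℕ) - 1),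
    (j : Module.End ℚ (CyclotomicField (cycLevel 3 0 r) ℚ)) *
      (sigma (cycLevel 3 0 r) (modNCyclotomicCharacter ℚ (cycLevel 3 0 r)
          ((τ : HeightOneSpectrum (𝓞 ℚ) → absoluteGaloisGroup ℚ) ℓ)) :
        CyclotomicField (cycLevel 3 0 r) ℚ →ₐ[ℚ] CyclotomicField (cycLevel 3 0 r) ℚ).toLinearMap ^ j

set_option backward.isDefEq.respectTransparency false in
/-- **★★★ «TamDiv∞» in Kurihara currency FROM KATO'S EULER SYSTEM, every Kolyvagin-datum binder
DISCHARGED under the `3`-adic tower** (module docstring §3).  For `W/ℚ` with `ρ_{E,3^n}` onto for all `n`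
and `3^{m+1} ∣ c_ℓ` at ONE finite `ℓ ∤ 3` (any reduction type at `3` and at `ℓ`), GRANTED: the named facts
`poitouTate_selmerStructure_duality ℚ` (Milne ADT I 4.10) and Tate's local Euler–Poincaré characteristic
at every finite place; primitive roots `η`; and ★ PK-6₂'s displayed inputs VERBATIM minus `hbad` — Kato's
`ZetaBody W 3 P₀.f …` at the conductor level (the body of the named fact
`Kato2004.exists_eulerSystem_expStar_values`), the (P-EXP) riders `KatoExpStarFiniteLevelAt W 3 j 0 v₃ Λ (Λfin j)`,
`hcdA`, `ht0` (`t = 0`), and the per-level value rows —: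
**`(m + 1 : ℕ∞) ≤ kuriharaPartialDeepInfty W 3 P₀.f`** (every Kurihara number of the newform at every
cyclic level `n ∈ 𝒩_{m+1}(E,3)` is divisible by `3^{m+1}`).  With `m + 1 = v₃(c_ℓ)` this is the (TD)
binder of crux 19679's corner road on the rows with ONE Tamagawa-`3` prime.
[cite: Buyukboduk2009TamagawaDefect, Thm. 3.1 and Cor. 3.3] [cite: MazurRubin2004, Thm. 3.2.4, Prop. 3.6.1, Thm. 5.2.12 (i), Prop. 6.2.6 and App. A Remark A.5]
[cite: Kato2004Asterisque, (8.1.3) (p. 180), §9.4 (p. 188) and Thm. 9.7 (p. 189)]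
[cite: Kim2022StructureSelmer, §1.2.2, Thm. 3.13 and Conj. 1.10 (PDF p. 8)] [cite: MilneADT2006, Ch. I, Thm. 4.10]
[cite: Sakamoto2024, §2, Lemma 5.2 and Cor. 5.5] -/
theorem natCast_le_kuriharaPartialDeepInfty_of_zetaBody_of_towerSurj
    (htower : ∀ n : ℕ, W.HasSurjectiveModNGaloisRep (3 ^ n : ℕ))
    (hPT : poitouTate_selmerStructure_duality ℚ)
    (hEP : ∀ v : HeightOneSpectrum (𝓞 ℚ), localEulerPoincareCharacteristic (v.adicCompletion ℚ))
    {ℓ : HeightOneSpectrum (𝓞 ℚ)} (h3ℓ : ((3 : ℕ) : 𝓞 ℚ) ∉ ℓ.asIdeal) (m : ℕ)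
    (hm : 3 ^ (m + 1) ∣ (W.baseChange (ℓ.adicCompletion ℚ)).localTamagawaNumber (ℓ.adicCompletionIntegers ℚ))
    (η : (q : HeightOneSpectrum (𝓞 ℚ)) → (ZMod (Ideal.absNorm q.asIdeal))ˣ)
    (hη : ∀ q, Subgroup.zpowers (η q) = ⊤)
    -- ★ PK-6₂'s displayed inputs (minus `hbad`)
    {N : ℕ} [NeZero N] (P₀ : ModularParametrizationData W N) (hN : N = W.conductorNorm ℤ)
    {ι : (n : ℕ) → (CyclotomicField n ℚ →+* ℂ)} {κK : ℝ}
    {Λ : ∀ (k' : ℕ) (r : Finset (HeightOneSpectrum (𝓞 ℚ))),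
      H1 (tateRep W 3) (cycSubgroup 3 k' r) →ₗ[ℤ_[3]] ℚ_[3] ⊗[ℚ] CyclotomicField (cycLevel 3 k' r) ℚ}
    {c d a : ℤ} {A : ℕ}
    {z : ∀ (k' : ℕ) (r : (cyclotomicLevelsRat 3 (badPlaces c d A N)).Ideals),
      H1 (tateRep W 3) ((cyclotomicLevelsRat 3 (badPlaces c d A N)).level k' r.1)}
    {x : ∀ (k' : ℕ) (r : (cyclotomicLevelsRat 3 (badPlaces c d A N)).Ideals),
      CyclotomicField (cycLevel 3 k' r.1) ℚ}
    (hbody : ZetaBody W 3 P₀.f ι κK Λ c d a A z x)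
    {v₃ : HeightOneSpectrum (𝓞 ℚ)} (hv₃ : ((3 : ℕ) : 𝓞 ℚ) ∈ v₃.asIdeal)
    (Λfin : ∀ j : ℕ, galoisCohomology ((W.torsionGaloisModule (((3 : ℕ) : ℤ) ^ j * ((3 : ℕ) : ℤ))).toLocal
      (Sum.inr v₃)) 1 →+ ZMod (3 ^ (j + 1)))
    (hfin : ∀ j : ℕ, KatoExpStarFiniteLevelAt W 3 j 0 v₃ Λ (Λfin j))
    (hcdA : ∀ q : ℕ, q.Prime → q ≡ 1 [MOD 3] → ¬ q ∣ 2 * c.natAbs * d.natAbs * A)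
    (ht0 : ∀ w : HeightOneSpectrum (𝓞 ℚ), ((3 : ℕ) : 𝓞 ℚ) ∈ w.asIdeal →
        ∀ Q : (W.baseChange (w.adicCompletion ℚ)).toAffine.Point, 3 • Q = 0 → Q = 0)
    (hvalue : ∀ (j : ℕ) (σ : HeightOneSpectrum (𝓞 ℚ) → absoluteGaloisGroup ℚ),
      (∀ q, σ q ∈ (adicCompletionPrime ℚ q).inertia (absoluteGaloisGroup ℚ)) →
      (∀ q, modNCyclotomicCharacter ℚ (Ideal.absNorm q.asIdeal) (σ q) = η q) →
      ∀ (r : Finset (HeightOneSpectrum (𝓞 ℚ)))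
        (hr : ∀ q ∈ r, q ∈ (cyclotomicLevelsRat 3 (badPlaces c d A N)).primes),
        (∀ q ∈ r, Kato.IsKolyvaginPrime W 3 (j + 1) ((primesEquiv q : Nat.Primes) : ℕ)) →
        (∀ q ∈ r, Subgroup.zpowers (η q) = ⊤) →
        ∃ (s : ℤ_[3]) (u : (ZMod (3 ^ (j + 1)))ˣ)
          (ψ : (ℓ : ℕ) → (ZMod ℓ)ˣ →* Multiplicative (ZMod (3 ^ (j + 1)))),
          (∀ q ∈ r, Function.Surjective (ψ (Ideal.absNorm q.asIdeal))) ∧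
          (∃ l ∈ cycIntLattice 3 (cycLevel 3 0 r),
            (((3 : ℕ) : ℤ_[3]) ^ (0 : ℕ)) • ((1 : ℚ_[3]) ⊗ₜ[ℚ]
              ((r.noncommProd 𝐃F⟦r, σ⟧ (ZetaValue.pairwise_commute_fieldDeriv (cycLevel 3 0 r)
                  (fun ℓ => modNCyclotomicCharacter ℚ (cycLevel 3 0 r) (σ ℓ))
                  (fun ℓ => ((primesEquiv ℓ : Nat.Primes) : ℕ) - 1) r))
                (x 0 ⟨r, hr⟩ + sigma (cycLevel 3 0 r) (-1) (x 0 ⟨r, hr⟩)))) -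
              ((s : ℚ_[3]) ⊗ₜ[ℚ] (1 : CyclotomicField (cycLevel 3 0 r) ℚ)) =
            (((3 : ℕ) : ℤ_[3]) ^ (j + 1)) • (l : ℚ_[3] ⊗[ℚ] CyclotomicField (cycLevel 3 0 r) ℚ)) ∧
          haveI : NeZero (∏ q ∈ r, Ideal.absNorm q.asIdeal) :=
            ⟨Finset.prod_ne_zero_iff.2 fun q _ h => q.ne_bot (Ideal.absNorm_eq_zero_iff.1 h)⟩
          PadicInt.toZModPow (j + 1) s = (u : ZMod (3 ^ (j + 1))) *
            ((3 : ℕ) : ZMod (3 ^ (j + 1))) ^ (0 : ℕ) *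
              kuriharaNumber P₀.f (3 ^ (j + 1)) (∏ q ∈ r, Ideal.absNorm q.asIdeal) ψ) :
    ((m + 1 : ℕ) : ℕ∞) ≤ kuriharaPartialDeepInfty W 3 P₀.f := by
  haveI : Fact (Nat.Prime 3) := ⟨Nat.prime_three⟩
  haveI : NeZero ((3 : ℕ) : ℚ) := ⟨by norm_num⟩
  haveI : Finite (geomTorsion W ((3 : ℕ) : ℤ)) :=
    finite_torsionPoints_holds W (AlgebraicClosure ℚ) (by norm_num)
  haveI : Finite (geomTorsion W (((3 : ℕ) : ℤ) ^ 0 * ((3 : ℕ) : ℤ))) := finite_geomTorsion_pow_mul W 3 0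
  obtain ⟨inv, hperf, hsum, -, hcompl⟩ := hPT 3
  obtain ⟨T, τ, D, h3T, hbadT, hTiff, hτ, hτ₁, hτμ, hP, hPT', hT, hD, hadm, hprime⟩ :=
    exists_pinnedData_of_towerSurj W htower m η hη
  exact natCast_le_kuriharaPartialDeepInfty_of_zetaBody_of_pow_succ_dvd W htower hperf hsum hcompl hEP T h3T
    hbadT h3ℓ m hm (torsion_fixed_eq_zero_of_towerSurj W htower) hTiff hτ hτ₁ (hτμ (m + 1)) D hP hPT' hT hD
    hadm hprime P₀ hN hbody hv₃ Λfin hfin hcdA ht0 hvalue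


set_option backward.isDefEq.respectTransparency false in
/-- **The (TD) binder on the rows with ONE Tamagawa-`3` prime, from Kato's Euler system under the tower**
(§3 with the exponent read as `v₃(c_ℓ)`; `c_ℓ ≠ 0` by `Rank1Residual.Additive.localTamagawaNumber_adicCompletion_ne_zero`):
for a tower row with `3 ∣ c_ℓ` at a finite `ℓ ∤ 3`, GRANTED Poitou–Tate, Tate's `hEP`, `η` and ★ PK-6₂'s
displayed inputs: **`(v₃(c_ℓ) : ℕ∞) ≤ kuriharaPartialDeepInfty W 3 P₀.f`** — the hypothesis `hTD` of
`KimAtThreeDeepLowerOffStratumCornerKeysSharp.stub_nonAdditive_of_sharpCornerLowerHalves_of_tamagawa_le_deepInfty`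
at `f = P₀.f` whenever `v₃(∏ c_ℓ) = v₃(c_ℓ)`. [cite: Buyukboduk2009TamagawaDefect, Thm. 3.1, Cor. 3.3 and §4.2 (Question 1)]
[cite: Kim2022StructureSelmer, Conj. 1.10 (PDF p. 8)] [cite: MazurRubin2004, App. A Remark A.5] -/
theorem natCast_padicValNat_le_kuriharaPartialDeepInfty_of_zetaBody_of_towerSurj
    (htower : ∀ n : ℕ, W.HasSurjectiveModNGaloisRep (3 ^ n : ℕ))
    (hPT : poitouTate_selmerStructure_duality ℚ)
    (hEP : ∀ v : HeightOneSpectrum (𝓞 ℚ), localEulerPoincareCharacteristic (v.adicCompletion ℚ))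
    {ℓ : HeightOneSpectrum (𝓞 ℚ)} (h3ℓ : ((3 : ℕ) : 𝓞 ℚ) ∉ ℓ.asIdeal)
    (h3c : 3 ∣ (W.baseChange (ℓ.adicCompletion ℚ)).localTamagawaNumber (ℓ.adicCompletionIntegers ℚ))
    (η : (q : HeightOneSpectrum (𝓞 ℚ)) → (ZMod (Ideal.absNorm q.asIdeal))ˣ)
    (hη : ∀ q, Subgroup.zpowers (η q) = ⊤)
    -- ★ PK-6₂'s displayed inputs (minus `hbad`)
    {N : ℕ} [NeZero N] (P₀ : ModularParametrizationData W N) (hN : N = W.conductorNorm ℤ)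
    {ι : (n : ℕ) → (CyclotomicField n ℚ →+* ℂ)} {κK : ℝ}
    {Λ : ∀ (k' : ℕ) (r : Finset (HeightOneSpectrum (𝓞 ℚ))),
      H1 (tateRep W 3) (cycSubgroup 3 k' r) →ₗ[ℤ_[3]] ℚ_[3] ⊗[ℚ] CyclotomicField (cycLevel 3 k' r) ℚ}
    {c d a : ℤ} {A : ℕ}
    {z : ∀ (k' : ℕ) (r : (cyclotomicLevelsRat 3 (badPlaces c d A N)).Ideals),
      H1 (tateRep W 3) ((cyclotomicLevelsRat 3 (badPlaces c d A N)).level k' r.1)}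
    {x : ∀ (k' : ℕ) (r : (cyclotomicLevelsRat 3 (badPlaces c d A N)).Ideals),
      CyclotomicField (cycLevel 3 k' r.1) ℚ}
    (hbody : ZetaBody W 3 P₀.f ι κK Λ c d a A z x)
    {v₃ : HeightOneSpectrum (𝓞 ℚ)} (hv₃ : ((3 : ℕ) : 𝓞 ℚ) ∈ v₃.asIdeal)
    (Λfin : ∀ j : ℕ, galoisCohomology ((W.torsionGaloisModule (((3 : ℕ) : ℤ) ^ j * ((3 : ℕ) : ℤ))).toLocal
      (Sum.inr v₃)) 1 →+ ZMod (3 ^ (j + 1)))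
    (hfin : ∀ j : ℕ, KatoExpStarFiniteLevelAt W 3 j 0 v₃ Λ (Λfin j))
    (hcdA : ∀ q : ℕ, q.Prime → q ≡ 1 [MOD 3] → ¬ q ∣ 2 * c.natAbs * d.natAbs * A)
    (ht0 : ∀ w : HeightOneSpectrum (𝓞 ℚ), ((3 : ℕ) : 𝓞 ℚ) ∈ w.asIdeal →
        ∀ Q : (W.baseChange (w.adicCompletion ℚ)).toAffine.Point, 3 • Q = 0 → Q = 0)
    (hvalue : ∀ (j : ℕ) (σ : HeightOneSpectrum (𝓞 ℚ) → absoluteGaloisGroup ℚ),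
      (∀ q, σ q ∈ (adicCompletionPrime ℚ q).inertia (absoluteGaloisGroup ℚ)) →
      (∀ q, modNCyclotomicCharacter ℚ (Ideal.absNorm q.asIdeal) (σ q) = η q) →
      ∀ (r : Finset (HeightOneSpectrum (𝓞 ℚ)))
        (hr : ∀ q ∈ r, q ∈ (cyclotomicLevelsRat 3 (badPlaces c d A N)).primes),
        (∀ q ∈ r, Kato.IsKolyvaginPrime W 3 (j + 1) ((primesEquiv q : Nat.Primes) : ℕ)) →
        (∀ q ∈ r, Subgroup.zpowers (η q) = ⊤) →
        ∃ (s : ℤ_[3]) (u : (ZMod (3 ^ (j + 1)))ˣ)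
          (ψ : (ℓ : ℕ) → (ZMod ℓ)ˣ →* Multiplicative (ZMod (3 ^ (j + 1)))),
          (∀ q ∈ r, Function.Surjective (ψ (Ideal.absNorm q.asIdeal))) ∧
          (∃ l ∈ cycIntLattice 3 (cycLevel 3 0 r),
            (((3 : ℕ) : ℤ_[3]) ^ (0 : ℕ)) • ((1 : ℚ_[3]) ⊗ₜ[ℚ]
              ((r.noncommProd 𝐃F⟦r, σ⟧ (ZetaValue.pairwise_commute_fieldDeriv (cycLevel 3 0 r)
                  (fun ℓ => modNCyclotomicCharacter ℚ (cycLevel 3 0 r) (σ ℓ))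
                  (fun ℓ => ((primesEquiv ℓ : Nat.Primes) : ℕ) - 1) r))
                (x 0 ⟨r, hr⟩ + sigma (cycLevel 3 0 r) (-1) (x 0 ⟨r, hr⟩)))) -
              ((s : ℚ_[3]) ⊗ₜ[ℚ] (1 : CyclotomicField (cycLevel 3 0 r) ℚ)) =
            (((3 : ℕ) : ℤ_[3]) ^ (j + 1)) • (l : ℚ_[3] ⊗[ℚ] CyclotomicField (cycLevel 3 0 r) ℚ)) ∧
          haveI : NeZero (∏ q ∈ r, Ideal.absNorm q.asIdeal) :=
            ⟨Finset.prod_ne_zero_iff.2 fun q _ h => q.ne_bot (Ideal.absNorm_eq_zero_iff.1 h)⟩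
          PadicInt.toZModPow (j + 1) s = (u : ZMod (3 ^ (j + 1))) *
            ((3 : ℕ) : ZMod (3 ^ (j + 1))) ^ (0 : ℕ) *
              kuriharaNumber P₀.f (3 ^ (j + 1)) (∏ q ∈ r, Ideal.absNorm q.asIdeal) ψ) :
    ((padicValNat 3 ((W.baseChange (ℓ.adicCompletion ℚ)).localTamagawaNumber
        (ℓ.adicCompletionIntegers ℚ)) : ℕ) : ℕ∞) ≤ kuriharaPartialDeepInfty W 3 P₀.f := by
  haveI : Fact (Nat.Prime 3) := ⟨Nat.prime_three⟩
  have hc0 := Summit.BirchSwinnertonDyer.Rank1Residual.Additive.localTamagawaNumber_adicCompletion_ne_zero W ℓ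
  have hv1 : 1 ≤ padicValNat 3 ((W.baseChange (ℓ.adicCompletion ℚ)).localTamagawaNumber
      (ℓ.adicCompletionIntegers ℚ)) := one_le_padicValNat_of_dvd hc0 h3c
  obtain ⟨m, hmv⟩ : ∃ m, padicValNat 3 ((W.baseChange (ℓ.adicCompletion ℚ)).localTamagawaNumber
      (ℓ.adicCompletionIntegers ℚ)) = m + 1 := ⟨_, (Nat.sub_add_cancel hv1).symm⟩
  have hdvd : 3 ^ (m + 1) ∣ (W.baseChange (ℓ.adicCompletion ℚ)).localTamagawaNumber
      (ℓ.adicCompletionIntegers ℚ) := hmv ▸ pow_padicValNat_dvd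
  rw [hmv]
  exact natCast_le_kuriharaPartialDeepInfty_of_zetaBody_of_towerSurj W htower hPT hEP h3ℓ m hdvd η hη P₀ hN hbody
    hv₃ Λfin hfin hcdA ht0 hvalue

end End

end Summit.BirchSwinnertonDyer.BirchSwinnertonDyer.Theorems.KimAtThreeD7uTamagawaKuriharaTower

end
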